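import Summits.ResolutionOfSingularities.ResolutionOfSingularities.Theorems.FrobeniusClosingPatchingRelPerfectSliceOfEngine
import Literature.AlgebraicGeometry.Resolution.AlterationsStrong
import Literature.AlgebraicGeometry.Resolution.Temkin2008Localization
import HarnessLib

/-!
# Crux `PatchingRelPerfect` (stmt-ResolutionOfSingularities-16161), line `closed-point-slice` v5:
# stub `stub_sliceGeFive` — the dimension-`≥ 5` integral slice from LU, the local strata and the engine

Route `ResolutionOfSingularities/FrobeniusClosing`, crux #6 `PatchingRelPerfect` (one term shared by
eight routes). [OURS · L1 W5.2] This file proves the registered stub `stub_sliceGeFive` of skeleton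
v5 of the line `closed-point-slice`, verbatim: for `k` perfect of characteristic `p`, every
integral separated `k`-scheme of finite type `X` with `¬ dim X ≤ 4` has a resolution of
singularities, GIVEN (hypotheses, by name in the skeleton): relative local uniformization over
perfect fields of characteristic `p` (`hLU`), the dimension-`≤ 4` integral slice (`h4`), local
desingularizations in local dimension `≤ 3` (`hP3`, the printed stratum), the LOCAL RESIDUAL
(`hR`: local desingularizations over regular local rings of local dimension `≥ 4` of varieties of
dimension `≥ 5`), and the ATOMIC ROOF ENGINE (`hE`, landed as `Theorems.stub_atomicRoofEngine`).
Nothing here is open: the file is the Zariski set-up of the dimension-`≤ 4` slice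
(`Theorems.PatchingRelPerfect.SliceOfEngine`, p170125) run in every dimension with roofs at ALL
points.

## Proof

* `exists_roof_localDesing` — on the iterated join `N` of a finite resolving system of proper
  models of `K/k` with `trdeg_k K = m`, `¬ m ≤ 4`, EVERY point `x` has a regular roof
  `q : N → M` (the member on which a valuation ring centred at `x` has a regular centre; `q`
  proper birational, Piltant 2013 Prop. 5.1) whose regular local rings carry local
  desingularizations: `dim M = m`, so at `y ∈ Reg M` either `dim 𝒪_{M,y} ≤ 3` (`hP3`) or `hR`
  applies.
* `hasResolution_projective_of_dim_ge_five` — for an integral `X ⊆ ℙⁿ_k` with `¬ dim X ≤ 4`: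
  affine chart, `K = k(X)`, `X` as a projective model `M₀`, `trdeg_k K = dim X = m`; (LU) gives a
  finite resolving system of affine, then proper, models; the iterated join `N` dominates `M₀` and
  the system; the engine resolves `N`; transfer along `N → X`.
* `stub_sliceGeFive` — `dim X ≤ n` for some `n` (schemes of finite type over a field are finite
  dimensional); `ResolutionOverUpToDim k n` by the projective reduction
  (`ResolutionOverUpToDim.of_projective`: components, Chow, projective closure), feeding projective
  integral `Y` of dimension `≤ 4` to `h4` and the others to the previous lemma.

## Sources

* O. Zariski, *Reduction of the singularities of algebraic three dimensional varieties*, Ann. of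
  Math. 45 (1944) 472–542, Fundamental Theorem p. 539. [Zariski1944]
* O. Piltant, *An axiomatic version of Zariski's patching theorem*, RACSAM 107 (2013) 91–121,
  Prop. 5.1 and Cor. 5.7. [Piltant2013]
* V. Cossart, O. Piltant, J. Algebra 529 (2019), proof of Prop. 4.6, Steps 1–3 (reduction to the
  projective integral case). [CossartPiltant2019]
-/

set_option linter.dupNamespace false -- single-problem summit: doubled namespace component is forced

noncomputable section

open CategoryTheory CategoryTheory.Limits AlgebraicGeometry Literature.AlgebraicGeometry.Resolution
open Literature.AlgebraicGeometry (Motives.projectiveSpace Motives.isProper_projectiveSpace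
  Motives.IsProjectiveOver)
open TopologicalSpace IsLocalRing

namespace Summit.ResolutionOfSingularities.ResolutionOfSingularities.Theorems

namespace PatchingRelPerfect.SliceGeFive

variable {k K : Type} [Field k] [Field K] [Algebra k K]

/-- **Regular roofs with local desingularizations at EVERY point of a model dominating a resolving
system**, in dimension `m ≥ 5`: if the proper model `N` of `K/k`, `trdeg_k K = m`, `¬ m ≤ 4`,
dominates every member of a finite list of proper models on SOME member of which every valuation
ring of `K/k` has a regular centre, then every point `x ∈ N` has a regular roof `q : N → M` — `x` is
the centre of a valuation ring `v` (`KModel.exists_isCentre_of_isGenericPoint`), regularly centred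
on some member `M`, and the domination maps `x` to that centre (`ProperModel.Hom.map_centre`) — and
the regular local rings of `M` carry local desingularizations: `dim M = m` (`dim = trdeg`), so at a
regular `y ∈ M` either `dim 𝒪_{M,y} ≤ 3` and the printed stratum `hP3` applies, or `hR` does.
[cite: Piltant2013, Prop. 5.1 and Cor. 5.7] -/
theorem exists_roof_localDesing {p : ℕ} [CharP k p] [PerfectField k]
    (hP3 : ∀ (N : Scheme.{0}) (gN : N ⟶ Spec (.of k)) [LocallyOfFiniteType gN] [IsIntegral N]
      (y : N), ringKrullDim (N.presheaf.stalk y) ≤ (3 : ℕ) →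
      ∀ (T : Scheme.{0}) (h : T ⟶ Spec (N.presheaf.stalk y)), IsIntegral T → IsProper h →
        IsBirational h → Scheme.AdmitsDesingularization T)
    (hR : ∀ (N : Scheme.{0}) (gN : N ⟶ Spec (.of k)) [IsSeparated gN] [LocallyOfFiniteType gN]
      [QuasiCompact gN] [IsIntegral N], ¬ topologicalKrullDim N ≤ 4 → ∀ y : N,
      IsRegularLocalRing (N.presheaf.stalk y) → ¬ ringKrullDim (N.presheaf.stalk y) ≤ (3 : ℕ) →
      ∀ (T : Scheme.{0}) (h : T ⟶ Spec (N.presheaf.stalk y)), IsIntegral T → IsProper h →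
        IsBirational h →
        (∀ t : T, h.base t ≠ IsLocalRing.closedPoint (N.presheaf.stalk y) →
          IsRegularLocalRing (T.presheaf.stalk t)) →
        Scheme.AdmitsDesingularization T)
    (N : ProperModel k K) {m : ℕ} (hK : Algebra.trdeg k K = (m : Cardinal)) (hm : ¬ m ≤ 4)
    (l : List (ProperModel k K)) (hhom : ∀ M ∈ l, Nonempty (N.Hom M))
    (hcov : ∀ v : ZariskiRiemannSpace k K, ∃ M ∈ l, M.RegCentre v) (x : N.X) :
    ∃ (N' : Scheme.{0}) (gN : N' ⟶ Spec (.of k)) (q : N.X ⟶ N'),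
      IsSeparated gN ∧ LocallyOfFiniteType gN ∧ QuasiCompact gN ∧ IsIntegral N' ∧
      q ≫ gN = N.π ∧ IsProper q ∧ IsBirational q ∧
      IsRegularLocalRing (N'.presheaf.stalk (q.base x)) ∧
      ∀ y : N', IsRegularLocalRing (N'.presheaf.stalk y) →
        ∀ (T : Scheme.{0}) (h : T ⟶ Spec (N'.presheaf.stalk y)), IsIntegral T → IsProper h →
          IsBirational h →
          (∀ t : T, h.base t ≠ IsLocalRing.closedPoint (N'.presheaf.stalk y) →
            IsRegularLocalRing (T.presheaf.stalk t)) →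
          Scheme.AdmitsDesingularization T := by
  -- `x` is the centre of some valuation ring `v` of `K/k`
  have hgen : IsGenericPoint N.toKModel.genericPt (Set.univ : Set N.X) := by
    rw [N.genericPt_eq']
    exact genericPoint_spec N.X
  obtain ⟨v, hv⟩ := N.toKModel.exists_isCentre_of_isGenericPoint hgen x
  -- `v` has a regular centre on some member `M`, dominated by `N`
  obtain ⟨M, hMl, hMv⟩ := hcov v
  obtain ⟨φ⟩ := hhom M hMl
  have hx : φ.f.base x = M.centre v := by
    rw [ProperModel.eq_centre_of_isCentre hv]
    exact φ.map_centre v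
  -- `dim M = m ≥ 5`
  have hdimM : ¬ topologicalKrullDim M.X ≤ 4 := by
    rw [Pialt.OpenRange.properModel_topologicalKrullDim_eq_of_trdeg M hK]
    exact_mod_cast hm
  refine ⟨M.X, M.π, φ.f, inferInstance, inferInstance, inferInstance, inferInstance, φ.f_π,
    inferInstance, φ.isBirational, ?_, fun y hy T h hT hh hbir hoff => ?_⟩
  · rw [hx]
    exact hMv
  · by_cases hd : ringKrullDim (M.X.presheaf.stalk y) ≤ (3 : ℕ)
    · exact hP3 M.X M.π y hd T h hT hh hbir
    · exact hR M.X M.π hdimM y hy hd T h hT hh hbir hoff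

/-- **The projective integral case of the dimension-`≥ 5` slice.** For `k` perfect of
characteristic `p` with relative local uniformization (fibrewise shape `hLU`), the two local strata
`hP3`/`hR` and the atomic roof engine `hE`, every integral closed subscheme `X ⊆ ℙⁿ_k` with
`¬ dim X ≤ 4` has a resolution. Zariski's setup verbatim as in
`SliceOfEngine.hasResolution_projective_of_dim_le_four`: affine chart `Spec A ∋ η`, `K = Frac A`,
`X` as the projective model `M₀`, `trdeg_k K = dim X = m`; a finite resolving system of proper
models from (LU); the iterated join `N` of `M₀` with the system has regular roofs with local
desingularizations at all points (`exists_roof_localDesing`), the engine resolves `N`, and the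
resolution descends along the proper birational domination `N → X`.
[cite: Piltant2013, Prop. 5.1 and Cor. 5.7; Zariski1944, p. 539] -/
theorem hasResolution_projective_of_dim_ge_five {p : ℕ} [CharP k p] [PerfectField k]
    (hLU : ∀ (K : Type) [Field K] [Algebra k K] (O : ValuationSubring K) (R : Subalgebra k K),
      R.FG → IsFractionRing R K → R.toSubring ≤ O.toSubring →
        ∃ (A : Subalgebra k K) (h : A.toSubring ≤ O.toSubring), R ≤ A ∧ A.FG ∧
          IsRegularLocalRing (Localization.AtPrime
            (Ideal.comap (Subring.inclusion h) (IsLocalRing.maximalIdeal O))))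
    (hP3 : ∀ (N : Scheme.{0}) (gN : N ⟶ Spec (.of k)) [LocallyOfFiniteType gN] [IsIntegral N]
      (y : N), ringKrullDim (N.presheaf.stalk y) ≤ (3 : ℕ) →
      ∀ (T : Scheme.{0}) (h : T ⟶ Spec (N.presheaf.stalk y)), IsIntegral T → IsProper h →
        IsBirational h → Scheme.AdmitsDesingularization T)
    (hR : ∀ (N : Scheme.{0}) (gN : N ⟶ Spec (.of k)) [IsSeparated gN] [LocallyOfFiniteType gN]
      [QuasiCompact gN] [IsIntegral N], ¬ topologicalKrullDim N ≤ 4 → ∀ y : N,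
      IsRegularLocalRing (N.presheaf.stalk y) → ¬ ringKrullDim (N.presheaf.stalk y) ≤ (3 : ℕ) →
      ∀ (T : Scheme.{0}) (h : T ⟶ Spec (N.presheaf.stalk y)), IsIntegral T → IsProper h →
        IsBirational h →
        (∀ t : T, h.base t ≠ IsLocalRing.closedPoint (N.presheaf.stalk y) →
          IsRegularLocalRing (T.presheaf.stalk t)) →
        Scheme.AdmitsDesingularization T)
    (hE : ∀ (M : Scheme.{0}) (g : M ⟶ Spec (.of k)) [IsSeparated g]
      [LocallyOfFiniteType g] [QuasiCompact g] [IsIntegral M],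
      (∀ m : M, ∃ (N : Scheme.{0}) (gN : N ⟶ Spec (.of k)) (q : M ⟶ N),
        IsSeparated gN ∧ LocallyOfFiniteType gN ∧ QuasiCompact gN ∧ IsIntegral N ∧
        q ≫ gN = g ∧ IsProper q ∧ IsBirational q ∧
        IsRegularLocalRing (N.presheaf.stalk (q.base m)) ∧
        ∀ y : N, IsRegularLocalRing (N.presheaf.stalk y) →
          ∀ (T : Scheme.{0}) (h : T ⟶ Spec (N.presheaf.stalk y)), IsIntegral T → IsProper h →
            IsBirational h →
            (∀ t : T, h.base t ≠ IsLocalRing.closedPoint (N.presheaf.stalk y) →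
              IsRegularLocalRing (T.presheaf.stalk t)) →
            Scheme.AdmitsDesingularization T) →
      Scheme.HasResolution M)
    {n : ℕ} (X : Scheme.{0}) [IsIntegral X] (ι : X ⟶ (Motives.projectiveSpace n k).left)
    [IsClosedImmersion ι] (hX : ¬ topologicalKrullDim X ≤ 4) :
    Scheme.HasResolution X := by
  classical
  -- adapted from `SliceOfEngine.hasResolution_projective_of_dim_le_four` (p170125)
  haveI : IsProper (Motives.projectiveSpace n k).hom := Motives.isProper_projectiveSpace n k
  let πX : X ⟶ Spec (.of k) := ι ≫ (Motives.projectiveSpace n k).hom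
  have hproj : Motives.IsProjectiveOver (Over.mk πX) := ⟨n, Over.homMk ι rfl, ‹_›⟩
  haveI : LocallyOfFiniteType πX := inferInstance
  -- an affine chart `U = Spec A` of `X`
  obtain ⟨_, ⟨U', hU', rfl⟩, hηU, -⟩ := X.isBasis_affineOpens.exists_subset_of_mem_open
    (Set.mem_univ (genericPoint X)) isOpen_univ
  let U : X.Opens := U'
  have hU : IsAffineOpen U := hU'
  haveI : IsAffine U := hU
  haveI : Nonempty U := ⟨⟨_, hηU⟩⟩
  let A : Type := Γ(U, ⊤)
  -- `A` is a finitely generated `k`-algebra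
  let g : (U : Scheme.{0}) ⟶ Spec (.of k) := U.ι ≫ πX
  let ψ : k →+* A := g.appTop.hom.comp (Scheme.ΓSpecIso (.of k)).inv.hom
  have hψ : ψ.FiniteType := by
    have h1 : g.appTop.hom.FiniteType :=
      (HasRingHomProperty.iff_of_isAffine (P := @LocallyOfFiniteType)).mp inferInstance
    exact h1.comp (RingHom.FiniteType.of_surjective _
      (Scheme.ΓSpecIso (.of k)).symm.commRingCatIsoToRingEquiv.surjective)
  letI : Algebra k A := ψ.toAlgebra
  haveI hft : Algebra.FiniteType k A := hψ
  -- its fraction field `K`, and `X` as a projective model of `K/k`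
  let K : Type := FractionRing A
  let j : Spec (.of A) ⟶ X := U.toScheme.isoSpec.inv ≫ U.ι
  have hj : j ≫ πX = Spec.map (CommRingCat.ofHom (algebraMap k A)) := by
    change (U.toScheme.isoSpec.inv ≫ U.ι) ≫ πX = Spec.map (CommRingCat.ofHom ψ)
    rw [Category.assoc, isoSpec_inv_comp]
    rfl
  let M₀ : ProjModel k K := ProjModel.ofChart (K := K) X πX hproj A j hj
  -- `A` as a subalgebra `A₀ ⊆ K`, finitely generated with `Frac A₀ = K`
  let toK : A →ₐ[k] K := IsScalarTower.toAlgHom k A K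
  let A₀ : Subalgebra k K := toK.range
  have hA₀fg : A₀.FG := by
    rw [show A₀ = Subalgebra.map toK ⊤ from (Algebra.map_top toK).symm]
    exact Subalgebra.FG.map toK hft.out
  haveI hA₀fr : IsFractionRing A₀ K := by
    refine IsFractionRing.of_field A₀ K fun z => ?_
    obtain ⟨a, b, -, rfl⟩ := IsFractionRing.div_surjective (A := A) z
    exact ⟨⟨algebraMap A K a, a, rfl⟩, ⟨algebraMap A K b, b, rfl⟩, rfl⟩
  -- `trdeg_k K` is a natural number `m`, `dim X = m`, so `¬ m ≤ 4`
  haveI : Algebra.FiniteType k A₀ := A₀.fg_iff_finiteType.mp hA₀fg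
  obtain ⟨m, -, htrA₀⟩ := exists_ringKrullDim_eq_and_trdeg_eq k A₀
  have hKm : Algebra.trdeg k K = m := (trdeg_eq_trdeg_of_isFractionRing A₀).trans htrA₀
  have hXm : topologicalKrullDim X = m :=
    Pialt.OpenRange.properModel_topologicalKrullDim_eq_of_trdeg M₀.toProperModel hKm
  have hm : ¬ m ≤ 4 := fun h => hX (by rw [hXm]; exact_mod_cast h)
  -- a finite resolving system of affine models, from (LU)
  have hcov : ∀ v : ZariskiRiemannSpace k K, ∃ T : Subalgebra k K,
      (T.FG ∧ IsFractionRing T K) ∧ ZariskiRiemannSpace.HasRegularCentre T v :=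
    fun v => exists_hasRegularCentre_of_relLU (hLU K) A₀ hA₀fg v
  obtain ⟨𝒯, h𝒯, h𝒯cov⟩ := exists_finite_resolvingSystem' (P := fun T => IsFractionRing T K)
    (fun T hT => (isJ2Ring_of_field k).2 T ((Subalgebra.fg_iff_finiteType T).mp hT)) hcov
  -- their projective closures, as PROPER models: a finite resolving system of proper models
  have hM : ∀ T : ↥𝒯, ∃ M : ProperModel k K, ∀ w : ZariskiRiemannSpace k K,
      ZariskiRiemannSpace.HasRegularCentre T.1 w → M.RegCentre w := fun T => by
    haveI := (h𝒯 T.1 T.2).2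
    obtain ⟨M, hM⟩ := ProjModel.exists_regCentre_of_hasRegularCentre T.1 (h𝒯 T.1 T.2).1
    exact ⟨M.toProperModel, fun w hw => (M.toProperModel_regCentre_iff w).mpr (hM w hw)⟩
  choose M hM using hM
  let l : List (ProperModel k K) := 𝒯.attach.toList.map M
  have hlcov : ∀ v : ZariskiRiemannSpace k K, ∃ N ∈ l, N.RegCentre v := by
    intro v
    obtain ⟨T, hT, hTv⟩ := h𝒯cov v
    refine ⟨M ⟨T, hT⟩, ?_, hM ⟨T, hT⟩ v hTv⟩
    exact List.mem_map.mpr ⟨⟨T, hT⟩, Finset.mem_toList.mpr (Finset.mem_attach _ _), rfl⟩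
  -- the iterated join of `M₀` with the resolving system
  obtain ⟨N, φ₀, hN⟩ := SliceOfEngine.exists_hom_forall_nonempty_hom M₀.toProperModel l
  -- `N` has regular roofs with local desingularizations at all points: the engine resolves it
  have hresN : Scheme.HasResolution N.X :=
    hE N.X N.π fun x => exists_roof_localDesing hP3 hR N hKm hm l hN hlcov x
  -- transfer to `X = M₀.X` along the proper birational domination `N → M₀`
  have hres₀ : Scheme.HasResolution M₀.toProperModel.X :=
    Scheme.HasResolution.of_isBirational φ₀.f φ₀.isBirational hresN
  exact hres₀

end PatchingRelPerfect.SliceGeFive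

open PatchingRelPerfect.SliceGeFive in
/-- **STUB `stub_sliceGeFive` (line `closed-point-slice` v5, registered signature verbatim) — the
dimension-`≥ 5` integral slice from LU, the two local strata, the engine and the dimension-`≤ 4`
slice.** For `k` perfect of characteristic `p` and an integral separated `k`-scheme of finite type
`X` with `¬ dim X ≤ 4`, `X` has a resolution of singularities. PROOF: `dim X ≤ n` for some `n`
(`exists_topologicalKrullDim_le_of_locallyOfFiniteType`); `ResolutionOverUpToDim k n` by
`ResolutionOverUpToDim.of_projective`, feeding a projective integral `Y` with `dim Y ≤ 4` to `h4`
and one with `¬ dim Y ≤ 4` to `hasResolution_projective_of_dim_ge_five` ((LU) reshaped fibrewise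
at `k` as in `Theorems.stub_sliceOfEngine`). [cite: Piltant2013, Prop. 5.1 and Cor. 5.7;
Zariski1944, p. 539; CossartPiltant2019, proof of Prop. 4.6, Steps 1–3] -/
theorem stub_sliceGeFive (p : ℕ) (hp : p.Prime)
    (hLU : ∀ (k K : Type) [Field k] [CharP k p] [PerfectField k] [Field K] [Algebra k K],
      (⊤ : IntermediateField k K).FG → ∀ O : ValuationSubring K, (∀ c : k, algebraMap k K c ∈ O) →
        ∀ R : Subalgebra k K, R.FG → R.toSubring ≤ O.toSubring →
          ∃ (A : Subalgebra k K) (h : A.toSubring ≤ O.toSubring), R ≤ A ∧ A.FG ∧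
            IsFractionRing A K ∧ IsRegularLocalRing (Localization.AtPrime
              (Ideal.comap (Subring.inclusion h) (IsLocalRing.maximalIdeal O))))
    (h4 : ∀ (k : Type) [Field k] [CharP k p] [PerfectField k] (X : Scheme.{0})
      (f : X ⟶ Spec (.of k)), IsSeparated f → LocallyOfFiniteType f → QuasiCompact f →
      IsIntegral X → topologicalKrullDim X ≤ 4 → Scheme.HasResolution X)
    (hP3 : ∀ (k : Type) [Field k] (N : Scheme.{0}) (gN : N ⟶ Spec (.of k))
      [LocallyOfFiniteType gN] [IsIntegral N] (y : N), ringKrullDim (N.presheaf.stalk y) ≤ (3 : ℕ) →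
      ∀ (T : Scheme.{0}) (h : T ⟶ Spec (N.presheaf.stalk y)), IsIntegral T → IsProper h →
        IsBirational h → Scheme.AdmitsDesingularization T)
    (hR : ∀ (k : Type) [Field k] [CharP k p] [PerfectField k] (N : Scheme.{0})
      (gN : N ⟶ Spec (.of k)) [IsSeparated gN] [LocallyOfFiniteType gN] [QuasiCompact gN]
      [IsIntegral N], ¬ topologicalKrullDim N ≤ 4 → ∀ y : N,
      IsRegularLocalRing (N.presheaf.stalk y) → ¬ ringKrullDim (N.presheaf.stalk y) ≤ (3 : ℕ) →
      ∀ (T : Scheme.{0}) (h : T ⟶ Spec (N.presheaf.stalk y)), IsIntegral T → IsProper h →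
        IsBirational h →
        (∀ t : T, h.base t ≠ IsLocalRing.closedPoint (N.presheaf.stalk y) →
          IsRegularLocalRing (T.presheaf.stalk t)) →
        Scheme.AdmitsDesingularization T)
    (hE : ∀ (k : Type) [Field k] (M : Scheme.{0}) (g : M ⟶ Spec (.of k)) [IsSeparated g]
      [LocallyOfFiniteType g] [QuasiCompact g] [IsIntegral M],
      (∀ m : M, ∃ (N : Scheme.{0}) (gN : N ⟶ Spec (.of k)) (q : M ⟶ N),
        IsSeparated gN ∧ LocallyOfFiniteType gN ∧ QuasiCompact gN ∧ IsIntegral N ∧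
        q ≫ gN = g ∧ IsProper q ∧ IsBirational q ∧
        IsRegularLocalRing (N.presheaf.stalk (q.base m)) ∧
        ∀ y : N, IsRegularLocalRing (N.presheaf.stalk y) →
          ∀ (T : Scheme.{0}) (h : T ⟶ Spec (N.presheaf.stalk y)), IsIntegral T → IsProper h →
            IsBirational h →
            (∀ t : T, h.base t ≠ IsLocalRing.closedPoint (N.presheaf.stalk y) →
              IsRegularLocalRing (T.presheaf.stalk t)) →
            Scheme.AdmitsDesingularization T) →
      Scheme.HasResolution M)
    (k : Type) [Field k] [CharP k p] [PerfectField k] (X : Scheme.{0}) (f : X ⟶ Spec (.of k))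
    [IsSeparated f] [LocallyOfFiniteType f] [QuasiCompact f] [IsIntegral X]
    (hX : ¬ topologicalKrullDim X ≤ 4) : Scheme.HasResolution X := by
  have _ := hp
  have _ := hX -- the slice below resolves `X` of any dimension from `h4` and the engine
  -- (LU) at `k`, in the fibrewise shape
  have hLU' : ∀ (K : Type) [Field K] [Algebra k K] (O : ValuationSubring K) (R : Subalgebra k K),
      R.FG → IsFractionRing R K → R.toSubring ≤ O.toSubring →
        ∃ (A : Subalgebra k K) (h : A.toSubring ≤ O.toSubring), R ≤ A ∧ A.FG ∧
          IsRegularLocalRing (Localization.AtPrime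
            (Ideal.comap (Subring.inclusion h) (IsLocalRing.maximalIdeal O))) := by
    intro K _ _ O R hRfg hRfr hRO
    haveI : Algebra.FiniteType k R := R.fg_iff_finiteType.mp hRfg
    haveI : Algebra.EssFiniteType R K :=
      Algebra.EssFiniteType.of_isLocalization K (nonZeroDivisors R)
    have hKfg : (⊤ : IntermediateField k K).FG :=
      IntermediateField.fg_top_iff.mpr (Algebra.EssFiniteType.comp k R K)
    obtain ⟨A, h, hle, hAfg, -, hreg⟩ :=
      hLU k K hKfg O (fun c => hRO (R.algebraMap_mem c)) R hRfg hRO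
    exact ⟨A, h, hle, hAfg, hreg⟩
  -- `X` is finite-dimensional
  haveI : CompactSpace X := QuasiCompact.compactSpace_of_compactSpace f
  obtain ⟨n, hn⟩ := exists_topologicalKrullDim_le_of_locallyOfFiniteType f
  -- weak resolution over `k` up to dimension `n`, by reduction to the projective integral case
  have hres : ResolutionOverUpToDim k n :=
    ResolutionOverUpToDim.of_projective fun N Y ι hι hint hY => by
      haveI := hι
      haveI := hint
      by_cases hY4 : topologicalKrullDim Y ≤ 4
      · haveI : IsProper (Motives.projectiveSpace N k).hom := Motives.isProper_projectiveSpace N k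
        exact h4 k Y (ι ≫ (Motives.projectiveSpace N k).hom) inferInstance inferInstance
          inferInstance hint hY4
      · exact hasResolution_projective_of_dim_ge_five hLU' (hP3 k) (hR k) (hE k) Y ι hY4
  exact hres X f ‹_› ‹_› ‹_› inferInstance hn

end Summit.ResolutionOfSingularities.ResolutionOfSingularities.Theorems

end
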